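import Summits.QuantumFields.BalabanUV.T4Continuum.Support.NE7K1LinWalkLineEntries

/-!
# NE7K1LinWalkLineBlocks — row NE7 (node U5), candidate route HOM, path H1L, cell K1-lin(s): THE THREE OFF-DIAGONAL BLOCKS OF THE
# CUT-OFF COMMUTATOR `[diag(λ∘site), H_B]` ARE `ℓ²`-SMALL, with the bond oscillation `ℓ₁` of `λ` as the only small parameter

Lineage `b2b-balaban-t4-ne7-p2` (CRUX PROVER NE7 #2), generation 69; series (RW) file 12, over `NE7K1LinWalkLineEntries` (file 11: the
sparse-matrix bound, `|H_B(c, inr q)| ≤ 8(d+1)(nL)²∕L^{d+1}`, adjacency of the coarse sites behind a nonzero entry).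

* counting: `≤ 2(d+1)` coarse neighbours of a site either way round (`card_filter_nbrs_le`), hence `≤ 2(d+1)L^{d+1}` fluctuation labels
  over them (`card_filter_fst_le`);
* `comm_inr_entry` ∕ `comm_inr_entry'`: `|(λ(site c) − λ(q.1))·H_B(c, inr q)| ≤ θ := ℓ₁·8(d+1)(nL)²∕L^{d+1}` and a nonzero entry forces
  `q.1 ∼ site c`, for any coarse cut-off `λ` with `|λ_b − λ_{b′}| ≤ ℓ₁` across coarse bonds;
* **`comm_toBlocks₁₂_sq_le`**, **`comm_toBlocks₂₁_sq_le`**: `‖[Λ,H_B]₁₂ψ‖², ‖[Λ,H_B]₂₁a‖² ≤ θ²·2(d+1)L^{d+1}·2(d+1)·‖·‖²`;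
  **`comm_toBlocks₂₂_sq_le`**: `‖[Λ,H_B]₂₂ψ‖² ≤ θ²·(2(d+1)L^{d+1})²·‖ψ‖²` (`Λ = λ∘site`).  In the ψ-rescaled operator `𝒫♮(s)` of
  `NE7K1LinWalkLine` these blocks carry the factors `√s·μ`, `√s·μ`, `μ²` (`μ = 1∕n`): `μθ ∝ n·ℓ₁ = O(1∕M)` for `ℓ₁ = 4∕(Mn)` — NO power of
  the mesh survives (file 13 assembles the (H-comm) estimate).

HONEST FRAMING: [folklore] finite sums at the Gaussian `A = 0` level, crude constants; nothing of Bałaban's asserted; no `sorry`.  Census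
only (a helper toward the LINE's walk expansion); NO letter ∕ tag ∕ size of NE7 moves; NE7 NOT PRINTED ∕ NOT PROVED; spine 0∕9; FIXED
FINITE T⁴, rung (B)+1; NOT infinite volume, NOT mass gap, NOT Clay.  HONEST DEPENDENCY: continuum YM on T⁴ ⇐ BetaPertH ∧ nine spine
estimates (0/9 proved); BetaPertH ⇐ (D1) ∧ (D4) ∧ CAP+tail; G-an2-4 gates asym, D1 and NE2/3/4.
-/

noncomputable section

open Finset Matrix

namespace Summit.QuantumFields.BalabanUV.T4Continuum.NE7K1LinWalkLineBlocks

open Literature.MathematicalPhysics.QuantumFieldTheory.Balaban1983to89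
open Literature.MathematicalPhysics.QuantumFieldTheory.Balaban1983to89.B4Reflection242
open Literature.MathematicalPhysics.QuantumFieldTheory.Balaban1983to89.B4BoxCov237
open Literature.MathematicalPhysics.QuantumFieldTheory.Balaban1983to89.B4Lower18
open NE7K1LinSchurLineCoords NE7K1LinBlockCoords NE7K1LinSchurLineU1 NE7K1LinSchurLineU1Sharp NE7K1LinTwoRunKit
  NE7K1LinTwoRunUpper NE7K1LinWalkParametrix NE7K1LinWalkLine NE7K1LinWalkLineEntries

variable {d : ℕ}

/-! ### Counting, and the three off-diagonal blocks of the cut-off commutator -/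

section Blocks

variable {n L : ℕ} [NeZero L] {R' : Finset (Fin (d + 1) → ℤ)} (hn : 1 ≤ n) (hR' : IsBlockUnion (n * L) R') (a : ℝ)

omit [NeZero L] in
/-- at most `2(d+1)` coarse sites are neighbours of a given one (either way round). [folklore] -/
theorem card_filter_nbrs_le (x : Fin (d + 1) → ℤ) :
    ((univ.filter fun b : ↥(R'.image (blk L)) => b.1 ∈ nbrs x).card : ℝ) ≤ 2 * ((d : ℝ) + 1) ∧
      ((univ.filter fun b : ↥(R'.image (blk L)) => x ∈ nbrs b.1).card : ℝ) ≤ 2 * ((d : ℝ) + 1) := by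
  classical
  have key : ∀ z : Fin (d + 1) → ℤ, ((univ.filter fun b : ↥(R'.image (blk L)) => b.1 ∈ nbrs z).card : ℝ) ≤ 2 * ((d : ℝ) + 1) := by
    intro z
    have h1 : (univ.filter fun b : ↥(R'.image (blk L)) => b.1 ∈ nbrs z).card ≤ (nbrs z).card := by
      rw [← Finset.card_image_of_injective (univ.filter fun b : ↥(R'.image (blk L)) => b.1 ∈ nbrs z) Subtype.val_injective]
      refine Finset.card_le_card fun w hw => ?_
      obtain ⟨b, hb, rfl⟩ := Finset.mem_image.1 hw
      exact (Finset.mem_filter.1 hb).2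
    rw [card_nbrs] at h1
    exact_mod_cast h1
  refine ⟨key x, ?_⟩
  have e : (univ.filter fun b : ↥(R'.image (blk L)) => x ∈ nbrs b.1) = univ.filter fun b : ↥(R'.image (blk L)) => b.1 ∈ nbrs x := by
    ext b; simp only [Finset.mem_filter, Finset.mem_univ, true_and]; exact nbrs_comm
  rw [e]; exact key x

/-- a coarse predicate with at most `2(d+1)` solutions has at most `2(d+1)L^{d+1}` solutions among the fluctuation labels. [folklore] -/
theorem card_filter_fst_le (P : ↥(R'.image (blk L)) → Prop) [DecidablePred P]
    (hP : ((univ.filter P).card : ℝ) ≤ 2 * ((d : ℝ) + 1)) :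
    ((univ.filter fun q : ↥(R'.image (blk L)) × NZ d L => P q.1).card : ℝ) ≤ 2 * ((d : ℝ) + 1) * (L : ℝ) ^ (d + 1) := by
  classical
  have e : (univ.filter fun q : ↥(R'.image (blk L)) × NZ d L => P q.1) = (univ.filter P) ×ˢ (univ : Finset (NZ d L)) := by
    rw [← Finset.filter_product_left (s := (univ : Finset ↥(R'.image (blk L)))) (t := (univ : Finset (NZ d L))) P,
      Finset.univ_product_univ]
  rw [e, Finset.card_product, Finset.card_univ]
  have hNZ : (Fintype.card (NZ d L) : ℝ) ≤ (L : ℝ) ^ (d + 1) := by linarith [card_NZ_succ_le (d := d) (L := L)]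
  push_cast
  exact mul_le_mul hP hNZ (Nat.cast_nonneg _) (by positivity)

variable {lam : ↥(R'.image (blk L)) → ℝ} {ℓ₁ : ℝ} (hℓ₁ : 0 ≤ ℓ₁)
  (hbond : ∀ x y : ↥(R'.image (blk L)), y.1 ∈ nbrs x.1 → |lam x - lam y| ≤ ℓ₁)

include hn hR' hℓ₁ hbond in
/-- the commutator entries against a fluctuation column: `|(λ(site c) − λ(q.1))·H_B(c, inr q)| ≤ ℓ₁·8(d+1)(nL)²∕L^{d+1}`, and a nonzero
one forces `q.1 ∼ site c`. [folklore] -/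
theorem comm_inr_entry (c : Idx L R') (q : ↥(R'.image (blk L)) × NZ d L) :
    |comm (fun c : Idx L R' => lam (site c)) (runB (isBlockUnion_fine hR') n a) c (Sum.inr q)| ≤
        ℓ₁ * (8 * ((d : ℝ) + 1) * ((n : ℝ) * L) ^ 2 / (L : ℝ) ^ (d + 1)) ∧
      (comm (fun c : Idx L R' => lam (site c)) (runB (isBlockUnion_fine hR') n a) c (Sum.inr q) ≠ 0 → q.1.1 ∈ nbrs (site c).1) := by
  have hB := abs_runB_inr_le hn hR' a c q
  have hpos : 0 ≤ 8 * ((d : ℝ) + 1) * ((n : ℝ) * L) ^ 2 / (L : ℝ) ^ (d + 1) := by positivity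
  rw [comm_apply]
  by_cases hne : site c = q.1
  · have : lam (site c) - lam (site (Sum.inr q : Idx L R')) = 0 := by rw [hne]; exact sub_self _
    rw [this, zero_mul, abs_zero]
    exact ⟨by positivity, fun h => absurd rfl h⟩
  · by_cases hz : runB (isBlockUnion_fine hR') n a c (Sum.inr q) = 0
    · rw [hz, mul_zero, abs_zero]
      exact ⟨by positivity, fun h => absurd rfl h⟩
    · have hadj := mem_nbrs_of_runB_inr_ne_zero hn hR' a hz hne
      refine ⟨?_, fun _ => hadj⟩
      rw [abs_mul]
      exact mul_le_mul (hbond _ _ hadj) hB (abs_nonneg _) hℓ₁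

include hn hR' hℓ₁ hbond in
/-- the transposed commutator entries. [folklore] -/
theorem comm_inr_entry' (q : ↥(R'.image (blk L)) × NZ d L) (c : Idx L R') :
    |comm (fun c : Idx L R' => lam (site c)) (runB (isBlockUnion_fine hR') n a) (Sum.inr q) c| ≤
        ℓ₁ * (8 * ((d : ℝ) + 1) * ((n : ℝ) * L) ^ 2 / (L : ℝ) ^ (d + 1)) ∧
      (comm (fun c : Idx L R' => lam (site c)) (runB (isBlockUnion_fine hR') n a) (Sum.inr q) c ≠ 0 → (site c).1 ∈ nbrs q.1.1) := by
  have hB := abs_runB_inr_le' hn hR' a q c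
  rw [comm_apply]
  by_cases hne : q.1 = site c
  · have : lam (site (Sum.inr q : Idx L R')) - lam (site c) = 0 := by rw [← hne]; exact sub_self _
    rw [this, zero_mul, abs_zero]
    exact ⟨by positivity, fun h => absurd rfl h⟩
  · by_cases hz : runB (isBlockUnion_fine hR') n a (Sum.inr q) c = 0
    · rw [hz, mul_zero, abs_zero]
      exact ⟨by positivity, fun h => absurd rfl h⟩
    · have hadj := mem_nbrs_of_runB_inr_ne_zero' hn hR' a hz hne
      refine ⟨?_, fun _ => hadj⟩
      rw [abs_mul]
      exact mul_le_mul (hbond _ _ hadj) hB (abs_nonneg _) hℓ₁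

include hn hR' hℓ₁ hbond in
/-- **THE `(1,2)` BLOCK**: `‖[diag(λ∘site),H_B]₁₂ψ‖² ≤ θ²·(2(d+1)L^{d+1})·(2(d+1))·‖ψ‖²`, `θ = ℓ₁·8(d+1)(nL)²∕L^{d+1}`. [folklore] -/
theorem comm_toBlocks₁₂_sq_le (ψ : ↥(R'.image (blk L)) × NZ d L → ℝ) :
    (comm (fun c : Idx L R' => lam (site c)) (runB (isBlockUnion_fine hR') n a)).toBlocks₁₂ *ᵥ ψ ⬝ᵥ
        (comm (fun c : Idx L R' => lam (site c)) (runB (isBlockUnion_fine hR') n a)).toBlocks₁₂ *ᵥ ψ ≤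
      (ℓ₁ * (8 * ((d : ℝ) + 1) * ((n : ℝ) * L) ^ 2 / (L : ℝ) ^ (d + 1))) ^ 2 * (2 * ((d : ℝ) + 1) * (L : ℝ) ^ (d + 1)) *
        (2 * ((d : ℝ) + 1)) * (ψ ⬝ᵥ ψ) := by
  classical
  refine mulVec_sq_le_of_sparse _ (fun (b : ↥(R'.image (blk L))) (q : ↥(R'.image (blk L)) × NZ d L) => q.1.1 ∈ nbrs b.1)
    (fun b q => (comm_inr_entry hn hR' a hℓ₁ hbond (Sum.inl b) q).1)
    (fun b q h => (comm_inr_entry hn hR' a hℓ₁ hbond (Sum.inl b) q).2 h) (by positivity)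
    (fun b => card_filter_fst_le (fun b' : ↥(R'.image (blk L)) => b'.1 ∈ nbrs b.1) (card_filter_nbrs_le b.1).1)
    (fun q => (card_filter_nbrs_le q.1.1).2) ψ

include hn hR' hℓ₁ hbond in
/-- **THE `(2,1)` BLOCK**: `‖[diag(λ∘site),H_B]₂₁a‖² ≤ θ²·(2(d+1))·(2(d+1)L^{d+1})·‖a‖²`. [folklore] -/
theorem comm_toBlocks₂₁_sq_le (av : ↥(R'.image (blk L)) → ℝ) :
    (comm (fun c : Idx L R' => lam (site c)) (runB (isBlockUnion_fine hR') n a)).toBlocks₂₁ *ᵥ av ⬝ᵥ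
        (comm (fun c : Idx L R' => lam (site c)) (runB (isBlockUnion_fine hR') n a)).toBlocks₂₁ *ᵥ av ≤
      (ℓ₁ * (8 * ((d : ℝ) + 1) * ((n : ℝ) * L) ^ 2 / (L : ℝ) ^ (d + 1))) ^ 2 * (2 * ((d : ℝ) + 1)) *
        (2 * ((d : ℝ) + 1) * (L : ℝ) ^ (d + 1)) * (av ⬝ᵥ av) := by
  classical
  refine mulVec_sq_le_of_sparse _ (fun (q : ↥(R'.image (blk L)) × NZ d L) (b : ↥(R'.image (blk L))) => b.1 ∈ nbrs q.1.1)
    (fun q b => (comm_inr_entry' hn hR' a hℓ₁ hbond q (Sum.inl b)).1)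
    (fun q b h => (comm_inr_entry' hn hR' a hℓ₁ hbond q (Sum.inl b)).2 h) (by positivity)
    (fun q => (card_filter_nbrs_le q.1.1).1)
    (fun b => card_filter_fst_le (fun q' : ↥(R'.image (blk L)) => b.1 ∈ nbrs q'.1) (card_filter_nbrs_le b.1).2) av

include hn hR' hℓ₁ hbond in
/-- **THE `(2,2)` BLOCK**: `‖[diag(λ∘site),H_B]₂₂ψ‖² ≤ θ²·(2(d+1)L^{d+1})²·‖ψ‖²`. [folklore] -/
theorem comm_toBlocks₂₂_sq_le (ψ : ↥(R'.image (blk L)) × NZ d L → ℝ) :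
    (comm (fun c : Idx L R' => lam (site c)) (runB (isBlockUnion_fine hR') n a)).toBlocks₂₂ *ᵥ ψ ⬝ᵥ
        (comm (fun c : Idx L R' => lam (site c)) (runB (isBlockUnion_fine hR') n a)).toBlocks₂₂ *ᵥ ψ ≤
      (ℓ₁ * (8 * ((d : ℝ) + 1) * ((n : ℝ) * L) ^ 2 / (L : ℝ) ^ (d + 1))) ^ 2 * (2 * ((d : ℝ) + 1) * (L : ℝ) ^ (d + 1)) *
        (2 * ((d : ℝ) + 1) * (L : ℝ) ^ (d + 1)) * (ψ ⬝ᵥ ψ) := by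
  classical
  refine mulVec_sq_le_of_sparse _ (fun (p q : ↥(R'.image (blk L)) × NZ d L) => q.1.1 ∈ nbrs p.1.1)
    (fun p q => (comm_inr_entry hn hR' a hℓ₁ hbond (Sum.inr p) q).1)
    (fun p q h => (comm_inr_entry hn hR' a hℓ₁ hbond (Sum.inr p) q).2 h) (by positivity)
    (fun p => card_filter_fst_le (fun b' : ↥(R'.image (blk L)) => b'.1 ∈ nbrs p.1.1) (card_filter_nbrs_le p.1.1).1)
    (fun q => card_filter_fst_le (fun b' : ↥(R'.image (blk L)) => q.1.1 ∈ nbrs b'.1) (card_filter_nbrs_le q.1.1).2) ψ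

end Blocks

end Summit.QuantumFields.BalabanUV.T4Continuum.NE7K1LinWalkLineBlocks

end
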